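import Mathlib.GroupTheory.SpecificGroups.Cyclic
import Mathlib.GroupTheory.Index
import Mathlib.Tactic.Abel
import Mathlib.Tactic.Linarith
import HarnessLib

/-!
# Matrix-unit actions on finite abelian groups (Morita theory for `M₂(𝔽_p)` by hand)

Fourteenth layer of the proof files for the named fact `brandtMatrix_comm` of `BrandtModule.lean`
(Vignéras, LNM 800, III §5 ex. 5.8; Eichler 1973, II §6 Thm. 2). The residue ring of a
residually split order is `M₂(𝔽_p)`; its (right) modules are the finite abelian groups `V`
carrying three endomorphisms `E, U, W` (the actions of `e = E₁₁`, `u = E₁₂`, `v = E₂₁`) with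
the matrix-unit relations (`IsMatrixUnitAction`). We prove the two facts of Morita theory used by
the Hecke recursion:

* `IsMatrixUnitAction.cornerEquiv`, `card_eq_corner_sq` — a stable subgroup `S` is
  `S ≅ T × T` with `T = S ∩ Fix E` its corner (`x ↦ (E x, W x)`), so `|S| = |T|²`; stable
  subgroups correspond bijectively to subgroups of the corner (`corner_ofCorner`,
  `ofCorner_corner`);
* `card_subgroups_eq_one`, `card_subgroups_eq_succ` — an elementary abelian group of order `p`
  (resp. `p²`) has `1` (resp. `p + 1`) subgroups of order `p`;
* `IsMatrixUnitAction.exists_generator` — if the corner of `V` has order `p²` then `V` is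
  generated, as a stable subgroup, by one element (`y = a + U b`).

## References

* M. Eichler, *The basis problem for modular forms and the traces of the Hecke operators*,
  LNM 320 (1973), Ch. II §6 (proof of Thm. 2: counting ideals between `I` and `p I` via
  `M₂(ℤ/p)`-modules) [Eichler1973].
-/

namespace Literature.NumberTheory.Automorphic

universe u

/-- **A right `M₂`-module structure by matrix units**: endomorphisms `E, U, W` of an abelian
group (`x ↦ x e`, `x ↦ x u`, `x ↦ x v`) with the relations of `e = E₁₁`, `u = E₁₂`, `v = E₂₁`,
`f = 1 − e = E₂₂` for a *right* action (`x (a b) = (x a) b`): `e² = e`, `e u = u`, `u e = 0`,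
`u² = 0`, `v² = 0`, `e v = 0`, `v e = v`, `u v = e`, `v u = f`. [folklore] -/
structure IsMatrixUnitAction {V : Type u} [AddCommGroup V] (E U W : V →+ V) : Prop where
  /-- `e e = e`. -/
  ee : ∀ x, E (E x) = E x
  /-- `e u = u`. -/
  eu : ∀ x, U (E x) = U x
  /-- `u e = 0`. -/
  ue : ∀ x, E (U x) = 0
  /-- `u u = 0`. -/
  uu : ∀ x, U (U x) = 0
  /-- `v v = 0`. -/
  ww : ∀ x, W (W x) = 0
  /-- `e v = 0`. -/
  ew : ∀ x, W (E x) = 0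
  /-- `v e = v`. -/
  we : ∀ x, E (W x) = W x
  /-- `u v = e`. -/
  uw : ∀ x, W (U x) = E x
  /-- `v u = f = 1 − e`. -/
  wu : ∀ x, U (W x) = x - E x

namespace IsMatrixUnitAction

variable {V : Type u} [AddCommGroup V] {E U W : V →+ V}

/-- A subgroup is **stable** if it is closed under `E, U, W` (i.e. an `M₂`-submodule). [folklore] -/
def IsStable (E U W : V →+ V) (S : AddSubgroup V) : Prop := ∀ x ∈ S, E x ∈ S ∧ U x ∈ S ∧ W x ∈ S

/-- The **corner** `S e = S ∩ Fix(E)` of a subgroup. [folklore] -/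
def corner (E : V →+ V) (S : AddSubgroup V) : AddSubgroup V where
  carrier := {x | x ∈ S ∧ E x = x}
  add_mem' := by
    rintro a b ⟨ha, ha'⟩ ⟨hb, hb'⟩
    exact ⟨S.add_mem ha hb, by rw [map_add, ha', hb']⟩
  zero_mem' := ⟨S.zero_mem, map_zero E⟩
  neg_mem' := by
    rintro a ⟨ha, ha'⟩
    exact ⟨S.neg_mem ha, by rw [map_neg, ha']⟩

/-- Membership in the corner (definitional). [folklore] -/
theorem mem_corner {S : AddSubgroup V} {x : V} : x ∈ corner E S ↔ x ∈ S ∧ E x = x := Iff.rfl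

/-- The corner is monotone. [folklore] -/
theorem corner_mono {S S' : AddSubgroup V} (h : S ≤ S') : corner E S ≤ corner E S' :=
  fun _ ⟨hx, hx'⟩ => ⟨h hx, hx'⟩

/-- The corner lies in the subgroup. [folklore] -/
theorem corner_le (S : AddSubgroup V) : corner E S ≤ S := fun _ hx => hx.1

/-- The stable subgroup `{x | E x ∈ T, W x ∈ T}` built from a subgroup `T` of the fixed points. [folklore] -/
def ofCorner (E W : V →+ V) (T : AddSubgroup V) : AddSubgroup V where
  carrier := {x | E x ∈ T ∧ W x ∈ T}
  add_mem' := by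
    rintro a b ⟨ha, ha'⟩ ⟨hb, hb'⟩
    exact ⟨by rw [map_add]; exact T.add_mem ha hb, by rw [map_add]; exact T.add_mem ha' hb'⟩
  zero_mem' := ⟨by rw [map_zero]; exact T.zero_mem, by rw [map_zero]; exact T.zero_mem⟩
  neg_mem' := by
    rintro a ⟨ha, ha'⟩
    exact ⟨by rw [map_neg]; exact T.neg_mem ha, by rw [map_neg]; exact T.neg_mem ha'⟩

/-- Membership in `ofCorner` (definitional). [folklore] -/
theorem mem_ofCorner {T : AddSubgroup V} {x : V} : x ∈ ofCorner E W T ↔ E x ∈ T ∧ W x ∈ T := Iff.rfl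

/-- Elements of a corner are fixed by `E`. [folklore] -/
theorem fixed_of_mem_corner {S : AddSubgroup V} {x : V} (hx : x ∈ corner E S) : E x = x := hx.2

section Basic

variable (h : IsMatrixUnitAction E U W)
include h

/-- `x = E x + U (W x)` (Peirce decomposition `x = x e + x f`, `x f = (x v) u`). [folklore] -/
theorem decomp (x : V) : x = E x + U (W x) := by rw [h.wu]; abel

/-- `W x = 0` for `x` fixed by `E`. [folklore] -/
theorem w_eq_zero_of_fixed {x : V} (hx : E x = x) : W x = 0 := by rw [← hx, h.ew]

/-- **`S ≅ S e × S e`** for a stable subgroup: `x ↦ (E x, W x)` with inverse `(a, b) ↦ a + U b`. [folklore] -/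
def cornerEquiv {S : AddSubgroup V} (hS : IsStable E U W S) : S ≃ corner E S × corner E S where
  toFun x := (⟨E x, (hS _ x.2).1, h.ee x⟩, ⟨W x, (hS _ x.2).2.2, h.we x⟩)
  invFun ab := ⟨ab.1 + U ab.2, S.add_mem ab.1.2.1 (hS _ ab.2.2.1).2.1⟩
  left_inv x := Subtype.ext (h.decomp x).symm
  right_inv ab := by
    obtain ⟨⟨a, ha, ha'⟩, ⟨b, hb, hb'⟩⟩ := ab
    simp only [map_add, h.ue, add_zero, h.uw, Prod.mk.injEq, Subtype.mk.injEq]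
    exact ⟨ha', by rw [h.w_eq_zero_of_fixed ha', zero_add, hb']⟩

/-- **`|S| = |S e|²`** for a stable subgroup. [folklore] -/
theorem card_eq_corner_sq {S : AddSubgroup V} (hS : IsStable E U W S) :
    Nat.card S = Nat.card (corner E S) ^ 2 := by
  rw [Nat.card_congr (h.cornerEquiv hS), Nat.card_prod, pow_two]

/-- `ofCorner T` is stable (for any subgroup `T`). [folklore] -/
theorem isStable_ofCorner (T : AddSubgroup V) : IsStable E U W (ofCorner E W T) := by
  rintro x ⟨hx, hx'⟩
  refine ⟨⟨?_, ?_⟩, ⟨?_, ?_⟩, ⟨?_, ?_⟩⟩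
  · rw [h.ee]; exact hx
  · rw [h.ew]; exact T.zero_mem
  · rw [h.ue]; exact T.zero_mem
  · rw [h.uw]; exact hx
  · rw [h.we]; exact hx'
  · rw [h.ww]; exact T.zero_mem

/-- `corner (ofCorner T) = T` for `T` inside the fixed points. [folklore] -/
theorem corner_ofCorner {T : AddSubgroup V} (hT : ∀ x ∈ T, E x = x) : corner E (ofCorner E W T) = T := by
  ext x
  rw [mem_corner, mem_ofCorner]
  constructor
  · rintro ⟨⟨hx, -⟩, hx'⟩
    rwa [hx'] at hx
  · intro hx
    have hx' := hT x hx
    exact ⟨⟨by rwa [hx'], by rw [h.w_eq_zero_of_fixed hx']; exact T.zero_mem⟩, hx'⟩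

/-- `ofCorner (corner S) = S` for a stable subgroup. [folklore] -/
theorem ofCorner_corner {S : AddSubgroup V} (hS : IsStable E U W S) : ofCorner E W (corner E S) = S := by
  ext x
  rw [mem_ofCorner, mem_corner, mem_corner]
  constructor
  · rintro ⟨⟨hEx, -⟩, ⟨hWx, -⟩⟩
    rw [h.decomp x]
    exact S.add_mem hEx (hS _ hWx).2.1
  · intro hx
    exact ⟨⟨(hS _ hx).1, h.ee x⟩, ⟨(hS _ hx).2.2, h.we x⟩⟩

/-- **Stable subgroups of order `n²` correspond to subgroups of order `n` of the corner of `V`.** [folklore] -/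
def stableEquiv (n : ℕ) :
    {S : AddSubgroup V // IsStable E U W S ∧ Nat.card S = n ^ 2} ≃
      {T : AddSubgroup V // T ≤ corner E ⊤ ∧ Nat.card T = n} where
  toFun S := ⟨corner E S.1, corner_mono le_top, by
    have := h.card_eq_corner_sq S.2.1
    rw [S.2.2] at this
    exact (Nat.pow_left_injective two_ne_zero this).symm⟩
  invFun T := ⟨ofCorner E W T.1, h.isStable_ofCorner T.1, by
    rw [h.card_eq_corner_sq (h.isStable_ofCorner T.1),
      h.corner_ofCorner fun x hx => fixed_of_mem_corner (T.2.1 hx), T.2.2]⟩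
  left_inv S := Subtype.ext (h.ofCorner_corner S.2.1)
  right_inv T := Subtype.ext (h.corner_ofCorner fun x hx => fixed_of_mem_corner (T.2.1 hx))

/-- **A generator.** If the corner `V e` of `V` has order `p²` (`p` prime, `p V = 0`) then some
`y ∈ V` lies in no proper stable subgroup: `y = a + U b` with `a, b` independent in `V e`
(`E y = a`, `W y = b`). [folklore] -/
theorem exists_generator [Finite V] {p : ℕ} (hp : p.Prime) (hpV : ∀ x : V, p • x = 0)
    (hcard : Nat.card (corner E (⊤ : AddSubgroup V)) = p ^ 2) :
    ∃ y : V, ∀ S : AddSubgroup V, IsStable E U W S → y ∈ S → S = ⊤ := by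
  haveI : Fact p.Prime := ⟨hp⟩
  set G := corner E (⊤ : AddSubgroup V)
  have hord : ∀ {x : V}, x ≠ 0 → addOrderOf x = p := fun hx => addOrderOf_eq_prime (hpV _) hx
  -- a non-zero `a ∈ G`
  have hG1 : 1 < Nat.card G := by rw [hcard]; exact Nat.one_lt_pow two_ne_zero hp.one_lt
  haveI : Nontrivial G := Finite.one_lt_card_iff_nontrivial.mp hG1
  obtain ⟨⟨a, haG⟩, ha0⟩ := exists_ne (0 : G)
  have ha0' : a ≠ 0 := fun h0 => ha0 (Subtype.ext h0)
  -- `b ∈ G` outside the line through `a`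
  have hline : Nat.card (AddSubgroup.zmultiples a) = p := by rw [Nat.card_zmultiples, hord ha0']
  have hlt : AddSubgroup.zmultiples a < G := by
    refine lt_of_le_of_ne ((AddSubgroup.zmultiples_le_of_mem haG)) fun heq => ?_
    have := hline; rw [heq, hcard, pow_two] at this
    exact absurd this (by nlinarith [hp.one_lt])
  obtain ⟨b, hbG, hb⟩ := SetLike.exists_of_lt hlt
  refine ⟨a + U b, fun S hS hy => ?_⟩
  have hfa : E a = a := fixed_of_mem_corner haG
  have hfb : E b = b := fixed_of_mem_corner hbG
  have haS : a ∈ S := by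
    have := (hS _ hy).1
    rwa [map_add, h.ue, add_zero, hfa] at this
  have hbS : b ∈ S := by
    have := (hS _ hy).2.2
    rwa [map_add, h.uw, h.w_eq_zero_of_fixed hfa, zero_add, hfb] at this
  -- the corner of `S` contains `a, b`, hence is `G`
  have hH : AddSubgroup.zmultiples a ⊔ AddSubgroup.zmultiples b ≤ corner E S :=
    sup_le (AddSubgroup.zmultiples_le_of_mem ⟨haS, hfa⟩) (AddSubgroup.zmultiples_le_of_mem ⟨hbS, hfb⟩)
  have hcS : corner E S = G := by
    refine le_antisymm (corner_mono le_top) ?_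
    -- `|corner S|` divides `p²`, exceeds `p`
    have hdvd : Nat.card (corner E S) ∣ p ^ 2 := hcard ▸ AddSubgroup.card_dvd_of_le (corner_mono le_top)
    obtain ⟨i, hi2, hi⟩ := (Nat.dvd_prime_pow hp).mp hdvd
    have hgt : p < Nat.card (corner E S) := by
      have h1 : Nat.card (AddSubgroup.zmultiples a) < Nat.card (AddSubgroup.zmultiples a ⊔ AddSubgroup.zmultiples b : AddSubgroup V) := by
        refine lt_of_le_of_ne (AddSubgroup.card_le_of_le le_sup_left) fun heq => hb ?_
        have := AddSubgroup.eq_of_le_of_card_ge (le_sup_left : AddSubgroup.zmultiples a ≤ _ ⊔ AddSubgroup.zmultiples b) heq.ge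
        exact this ▸ (le_sup_right : AddSubgroup.zmultiples b ≤ _) (AddSubgroup.mem_zmultiples b)
      rw [hline] at h1
      exact lt_of_lt_of_le h1 (AddSubgroup.card_le_of_le hH)
    have hi2' : i = 2 := by
      rw [hi] at hgt
      have : 1 < i := (Nat.pow_lt_pow_iff_right hp.one_lt).mp (by rwa [pow_one])
      omega
    exact (AddSubgroup.eq_of_le_of_card_ge (corner_mono le_top) (by rw [hi, hi2', ← hcard])).ge
  have hTop : IsStable E U W (⊤ : AddSubgroup V) := fun x _ =>
    ⟨AddSubgroup.mem_top _, AddSubgroup.mem_top _, AddSubgroup.mem_top _⟩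
  rw [← h.ofCorner_corner hS, hcS]
  exact h.ofCorner_corner hTop

end Basic

/-! ### Counting subgroups of order `p` in elementary abelian groups of order `p` and `p²` -/

section Count

variable [Finite V] {p : ℕ}

/-- An elementary abelian group of order `p` has exactly one subgroup of order `p`. [folklore] -/
theorem card_subgroups_eq_one (hp : p.Prime) (G : AddSubgroup V) (hG : Nat.card G = p) :
    Nat.card {T : AddSubgroup V // T ≤ G ∧ Nat.card T = p} = 1 := by
  have _ := hp
  rw [Nat.card_eq_one_iff_exists]
  exact ⟨⟨G, le_rfl, hG⟩, fun T => Subtype.ext (AddSubgroup.eq_of_le_of_card_ge T.2.1 (by rw [hG, T.2.2]))⟩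

/-- **An elementary abelian group of order `p²` has exactly `p + 1` subgroups of order `p`**:
the `p² − 1` non-zero elements each generate one, and each contains `p − 1` of them. [folklore] -/
theorem card_subgroups_eq_succ (hp : p.Prime) (G : AddSubgroup V) (hpG : ∀ x ∈ G, p • x = 0)
    (hG : Nat.card G = p ^ 2) :
    Nat.card {T : AddSubgroup V // T ≤ G ∧ Nat.card T = p} = p + 1 := by
  classical
  haveI : Fact p.Prime := ⟨hp⟩
  set L := {T : AddSubgroup V // T ≤ G ∧ Nat.card T = p}
  have hord : ∀ {x : V}, x ∈ G → x ≠ 0 → addOrderOf x = p := fun hx hx0 =>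
    addOrderOf_eq_prime (hpG _ hx) hx0
  -- the line through a non-zero element
  have hline : ∀ {x : V}, x ∈ G → x ≠ 0 → AddSubgroup.zmultiples x ≤ G ∧ Nat.card (AddSubgroup.zmultiples x) = p :=
    fun hx hx0 => ⟨AddSubgroup.zmultiples_le_of_mem hx, by rw [Nat.card_zmultiples, hord hx hx0]⟩
  -- a subgroup of order `p` is the line through each of its non-zero elements
  have heq : ∀ (T : L) {x : V}, x ∈ T.1 → x ≠ 0 → AddSubgroup.zmultiples x = T.1 := fun T x hx hx0 => by
    haveI : Finite T.1 := inferInstance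
    exact AddSubgroup.eq_of_le_of_card_ge (AddSubgroup.zmultiples_le_of_mem hx)
      (by rw [T.2.2, (hline (T.2.1 hx) hx0).2])
  -- non-zero elements of `G` ≃ pairs (line, non-zero element of the line)
  let φ : {x : V // x ∈ G ∧ x ≠ 0} ≃ Σ T : L, {x : V // x ∈ T.1 ∧ x ≠ 0} :=
    { toFun := fun x => ⟨⟨AddSubgroup.zmultiples x.1, hline x.2.1 x.2.2⟩,
        ⟨x.1, AddSubgroup.mem_zmultiples _, x.2.2⟩⟩
      invFun := fun Tx => ⟨Tx.2.1, Tx.1.2.1 Tx.2.2.1, Tx.2.2.2⟩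
      left_inv := fun x => rfl
      right_inv := fun ⟨⟨T, hT⟩, ⟨x, hxT, hx0⟩⟩ => by
        have heq' : AddSubgroup.zmultiples x = T := heq ⟨T, hT⟩ hxT hx0
        subst heq'
        rfl }
  haveI : Finite L := Finite.of_injective (fun T : L => (T.1 : Set V)) fun T T' hTT' =>
    Subtype.ext (SetLike.coe_injective hTT')
  letI : Fintype L := Fintype.ofFinite L
  -- non-zero elements of a subgroup of order `n` number `n - 1`
  have hnz : ∀ (H : AddSubgroup V), Nat.card {x : V // x ∈ H ∧ x ≠ 0} = Nat.card H - 1 := fun H => by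
    letI : Fintype H := Fintype.ofFinite H
    have e : {x : V // x ∈ H ∧ x ≠ 0} ≃ {x : H // ¬ x = 0} :=
      { toFun := fun x => ⟨⟨x.1, x.2.1⟩, fun h0 => x.2.2 (congrArg Subtype.val h0)⟩
        invFun := fun x => ⟨x.1.1, x.1.2, fun h0 => x.2 (Subtype.ext h0)⟩
        left_inv := fun _ => rfl
        right_inv := fun _ => rfl }
    rw [Nat.card_congr e, Nat.card_eq_fintype_card, Fintype.card_subtype_compl, Fintype.card_subtype_eq,
      Nat.card_eq_fintype_card]
  have hlhs : Nat.card {x : V // x ∈ G ∧ x ≠ 0} = p ^ 2 - 1 := by rw [hnz, hG]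
  have hrhs : Nat.card (Σ T : L, {x : V // x ∈ T.1 ∧ x ≠ 0}) = Nat.card L * (p - 1) := by
    rw [Nat.card_sigma, Finset.sum_congr rfl fun T _ => (hnz T.1).trans (by rw [T.2.2]),
      Finset.sum_const, Finset.card_univ, smul_eq_mul, Nat.card_eq_fintype_card]
  have hmain : Nat.card L * (p - 1) = (p + 1) * (p - 1) := by
    rw [← hrhs, ← Nat.card_congr φ, hlhs]
    simpa using Nat.sq_sub_sq p 1
  exact Nat.eq_of_mul_eq_mul_right (Nat.sub_pos_of_lt hp.one_lt) hmain

end Count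

end IsMatrixUnitAction

end Literature.NumberTheory.Automorphic
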